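import Mathlib
import Summits.ValiantsHypothesis.ValiantsHypothesis.Theses.ElementaryWordLength

/-!
# Sketch — crux WordLengthQP (stmt-ValiantsHypothesis-6623), ideator 1, round 1, card `generic-mahonian-pencil`

The q-permanent pencil `per_q = Σ_σ q^{inv σ} x_σ` through the diagonal monomial (q = 0), the
determinant (q = −1) and the permanent (q = 1); the EASY SET of the pencil at a quasi-polynomial
budget is a ℚ-definable constructible subset of ℂ, hence finite or cofinite, and Aut(ℂ/ℚ)-stable;
so the crux is EQUIVALENT to hardness of ONE transcendental member and to finiteness of the easy set.
Statements only (sorried); offered to crux-plan.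
-/

namespace Summit.ValiantsHypothesis.ValiantsHypothesis.Cruxes.WordLengthQP.GenericMahonianPencil

open Literature.Computability.AlgebraicComplexity
open Summit.ValiantsHypothesis.ValiantsHypothesis.Theses.ElementaryWordLength

noncomputable section

/-- Inversion number of a permutation of `Fin n`. -/
def inv {n : ℕ} (σ : Equiv.Perm (Fin n)) : ℕ :=
  (Finset.univ.filter (fun p : Fin n × Fin n => p.1 < p.2 ∧ σ p.2 < σ p.1)).card

/-- The q-permanent (Mahonian pencil): `per_q = Σ_σ q^{inv σ} Π_i x_{i,σ i}`;
`q = 1`: permanent, `q = -1`: determinant, `q = 0`: the diagonal monomial. -/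
def qperPoly (n : ℕ) (q : ℂ) : MvPolynomial (Fin n × Fin n) ℂ :=
  ∑ σ : Equiv.Perm (Fin n), MvPolynomial.C (q ^ inv σ) * ∏ i, MvPolynomial.X (i, σ i)

/-- Mahonian layer `P_k = Σ_{inv σ = k} x_σ`. -/
def mahonianLayer (n k : ℕ) : MvPolynomial (Fin n × Fin n) ℂ :=
  ∑ σ ∈ (Finset.univ.filter fun σ : Equiv.Perm (Fin n) => inv σ = k), ∏ i, MvPolynomial.X (i, σ i)

/-- The word predicate of the crux, for an arbitrary target `f` and length bound `L`. -/
def HasWord {n : ℕ} (f : MvPolynomial (Fin n × Fin n) ℂ) (L : ℕ) : Prop :=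
  ∃ w : List (Fin 3 × Fin 3 × ℂ × Option (Fin n × Fin n)), w.length ≤ L ∧ (∀ l ∈ w, l.1 ≠ l.2.1) ∧
    (w.map (fun l => Matrix.transvection l.1 l.2.1
      (MvPolynomial.C l.2.2.1 * l.2.2.2.elim 1 MvPolynomial.X))).prod =
      Matrix.transvection (0 : Fin 3) 2 f

/-- The EASY SET of the pencil at budget `c`, size `n`. -/
def easySet (c n : ℕ) : Set ℂ := {q | HasWord (qperPoly n q) (2 ^ ((Nat.log 2 n + c) ^ c))}

/-- C⁺ (form A): the easy set is eventually finite at every quasi-polynomial budget. -/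
def FinitePencil : Prop := ∀ c : ℕ, ∃ n : ℕ, (easySet c n).Finite

/-- C⁺ (form B): one fixed member `per_t` is hard. -/
def MemberHard (t : ℂ) : Prop := ∀ c : ℕ, ∃ n : ℕ, t ∉ easySet c n

/-! ### Bookkeeping identities (provable now) -/

theorem qperPoly_one (n : ℕ) : qperPoly n 1 = perPoly (Fin n) ℂ := by
  sorry

theorem qperPoly_eq_sum_layers (n : ℕ) (q : ℂ) :
    qperPoly n q = ∑ k ∈ Finset.range (n * (n - 1) / 2 + 1), MvPolynomial.C (q ^ k) * mahonianLayer n k := by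
  sorry

/-- `X` is literally `MemberHard 1`. -/
theorem wordLengthQP_iff_memberHard_one : WordLengthQP ↔ MemberHard 1 := by
  sorry

/-! ### The transfer (each direction elementary; the constructibility/automorphism step is the
only non-bookkeeping ingredient) -/

/-- Interpolation: if the easy set is infinite at budget `c` for every `n`, Lagrange interpolation in
`q` over `n(n-1)/2 + 1` easy nodes (scalars by torus conjugation, sums by concatenation) gives
quasi-polynomial words for `per_n = per_1`. Hence `X → FinitePencil`. -/
theorem finitePencil_of_wordLengthQP : WordLengthQP → FinitePencil := by
  sorry

/-- Completeness: `(x, q) ↦ per_q` is a VNP family in the variables `x` AND `q`; if `per ∈ VQF`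
then (per VNP-complete, VQF = VQP_e closed under p-projection) it has quasi-polynomial words with
`q`-letters, and substituting `q := q₀` gives words of the same length for every `q₀`: the easy set
is all of `ℂ`. Hence `FinitePencil → X`. (Uses `isVNPComplete_perPoly_holds`, `BCS1997_thm_21_33`,
`VpWordQp`-type conversion — all at qp scale.) -/
theorem wordLengthQP_of_finitePencil (hVp : VpWordQp) : FinitePencil → WordLengthQP := by
  sorry

/-- Genericity: the easy set is the image of a ℚ-variety, so it is constructible (finite or
cofinite) and stable under `Aut(ℂ/ℚ)`, which is transitive on transcendentals; therefore for a
transcendental `t`, `MemberHard t ↔ FinitePencil` (↔ X). -/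
theorem memberHard_iff_finitePencil {t : ℂ} (ht : Transcendental ℚ t) :
    MemberHard t ↔ FinitePencil := by
  sorry

/-- DISPROOF AVENUE handed to the cdisprove seat: infinitely many easy members at one budget
(e.g. all roots of unity, uniformly) refute the crux. -/
theorem not_wordLengthQP_of_infinite_easy (h : ∃ c : ℕ, ∀ n : ℕ, (easySet c n).Infinite) :
    ¬ WordLengthQP := by
  sorry

end

end Summit.ValiantsHypothesis.ValiantsHypothesis.Cruxes.WordLengthQP.GenericMahonianPencil
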